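import Mathlib.LinearAlgebra.DFinsupp
import Mathlib.LinearAlgebra.Eigenspace.Triangularizable
import Mathlib.Algebra.Algebra.Subalgebra.Centralizer
import HarnessLib

/-!
# The commutant of a multiplicity-free family of operators is commutative (Schur's lemma, «multiplicity one» form)

Topic `Literature/RingTheory/SimpleModule`; namespace `Literature.RingTheory.SimpleModule.MultiplicityFree`.  THEOREMS
ONLY (no definition, no named fact, no instance; Mathlib only).  Pure linear algebra written for the cell
`hodgecm-mathlib` (D-0151) as the algebraic half of the «multiplicity-one lever» by which the tree turns a
multiplicity-free decomposition of `H¹` under Hecke correspondences into «of CM-type»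
(`AlgebraicGeometry/HodgeTheory/CMTypeIffCentralizerCommutative`, `isOfCMType_of_centralizer_bettiCohomology_comm`:
«a semisimple family of algebraic correspondences acting on `H¹` with pairwise non-isomorphic irreducible constituents,
each of multiplicity one, has a commutative commutant (Schur)» — that sentence is proved here).

## Setting and results

`K` a field, `V` a `K`-vector space, `S ⊆ End_K V` ANY set of operators, and `W : ι → Submodule K V` an independent family
of `S`-stable subspaces spanning `V` (`iSupIndep W`, `⨆ W = ⊤`) such that

* (non-isomorphy, in the form Schur's lemma delivers it) for `i ≠ j` every `K`-linear map `V → V` carrying `W i` into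
  `W j` and commuting with `S` on `W i` vanishes on `W i` (`hzero`);
* (simplicity) each `W i` is non-zero with no proper non-zero `S`-stable subspace (`hsimple`).

Then (§2) every operator `c` commuting with `S` preserves each `W i` (`apply_mem_of_forall_commute`, from `hzero` alone;
§1 is private coordinate bookkeeping for Mathlib's `iSupIndep.linearEquiv : (Π₀ i, W i) ≃ V`);
(§3) over an algebraically closed `K` with the `W i` finite-dimensional it acts on `W i` by a scalar
(`exists_apply_eq_smul_of_forall_commute`); hence (§4) any two operators commuting with `S` commute with each other
(`commute_of_forall_commute`, `centralizer_comm`: the commutant `Subalgebra.centralizer K S` is commutative).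
This is Schur's lemma for semisimple multiplicity-free modules: Bourbaki, *Algèbre* Ch. VIII (2012), §3 n°2 Prop. 2 with
its Corollaire («Lemme de Schur») and Th. 1 (over an algebraically closed field the endomorphisms of a finite-dimensional simple
module are the homotheties), p. VIII.43; §4 n°6 Prop. 4 b) (a semisimple module that is the direct sum of simple submodules
`N_i` has isotypic components `M_λ = ⊕_{i ∈ I(λ)} N_i`), p. VIII.61, and Prop. 5 b) (`End_A(M) ≅ ∏_λ End_A(M_λ)`), p. VIII.62 —
with all `I(λ)` singletons the product is a product of (commutative) fields.  The formulation over a bare set of operators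
`S` and `K`-subspaces (rather than modules over the algebra generated by `S`) is ours, chosen to match the consumers
(Hecke operators on `K`-fixed vectors, `NumberTheory/Automorphic/HeckeFixedVectorsSimple`).

## References
* [BourbakiAlgebreVIII2012] N. Bourbaki, *Algèbre, Chapitre 8: Modules et anneaux semi-simples* (2012): §3 n°2 Prop. 2,
  Cor. (lemme de Schur), Th. 1 (p. VIII.43); §4 n°6 Prop. 4, Prop. 5 (pp. VIII.61–62).
-/

noncomputable section

namespace Literature.RingTheory.SimpleModule.MultiplicityFree

variable {K V : Type*} [Field K] [AddCommGroup V] [Module K V] {ι : Type*} {W : ι → Submodule K V}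

/-! ## §1 Coordinates in an internal direct sum (private bookkeeping) -/

section Proj

variable [DecidableEq ι] (ind : iSupIndep W) (top : ⨆ i, W i = ⊤)

/-- on `W i` the `i`-th coordinate (under Mathlib's `iSupIndep.linearEquiv : (Π₀ i, W i) ≃ V`) is the vector itself. [folklore] -/
private theorem coord_apply_of_mem_self {i : ι} {x : V} (hx : x ∈ W i) :
    (((ind.linearEquiv top).symm x i : W i) : V) = x := by
  simp only [ind.linearEquiv_symm_apply top hx, DFinsupp.single_eq_same]

/-- on `W i` the `j`-th coordinate, `j ≠ i`, vanishes. [folklore] -/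
private theorem coord_apply_of_mem_ne {i j : ι} (hij : j ≠ i) {x : V} (hx : x ∈ W i) :
    (((ind.linearEquiv top).symm x j : W j) : V) = 0 := by
  simp only [ind.linearEquiv_symm_apply top hx, DFinsupp.single_eq_of_ne hij, Submodule.coe_zero]

/-- a vector all of whose coordinates outside `i` vanish lies in `W i`. [folklore] -/
private theorem mem_of_forall_coord_eq_zero {i : ι} {v : V}
    (h : ∀ j, j ≠ i → (((ind.linearEquiv top).symm v j : W j) : V) = 0) : v ∈ W i := by
  set e := ind.linearEquiv top with he
  have hsingle : e.symm v = DFinsupp.single i (e.symm v i) := by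
    ext j
    by_cases hj : j = i
    · subst hj
      rw [DFinsupp.single_eq_same]
    · rw [DFinsupp.single_eq_of_ne hj]
      exact_mod_cast h j hj
  have hv : v = ((e.symm v i : W i) : V) := by
    conv_lhs => rw [← e.apply_symm_apply v, hsingle]
    simp only [he, iSupIndep.linearEquiv_apply, DFinsupp.sumAddHom_single, LinearMap.toAddMonoidHom_coe,
      Submodule.coe_subtype]
  rw [hv]
  exact Subtype.mem _

/-- **An operator preserving every constituent commutes with the coordinate projections.** [folklore] -/
private theorem coord_apply_eq_apply_coord {s : Module.End K V} (hs : ∀ i, ∀ x ∈ W i, s x ∈ W i) (j : ι) (v : V) :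
    (((ind.linearEquiv top).symm (s v) j : W j) : V) = s ((ind.linearEquiv top).symm v j : W j) := by
  have hv : v ∈ ⨆ i, W i := by rw [top]; exact Submodule.mem_top
  induction hv using Submodule.iSup_induction' with
  | mem i x hx =>
    by_cases hj : j = i
    · subst hj
      rw [coord_apply_of_mem_self ind top hx, coord_apply_of_mem_self ind top (hs _ x hx)]
    · rw [coord_apply_of_mem_ne ind top hj hx, coord_apply_of_mem_ne ind top hj (hs _ x hx), map_zero]
  | zero => simp only [map_zero, DFinsupp.zero_apply, Submodule.coe_zero]
  | add x y _ _ hx hy => simp only [map_add, DFinsupp.add_apply, Submodule.coe_add, hx, hy]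

end Proj

/-! ## §2 An operator commuting with `S` preserves every constituent -/

section Preserve

variable {S : Set (Module.End K V)} (ind : iSupIndep W) (top : ⨆ i, W i = ⊤)
  (hstab : ∀ i, ∀ s ∈ S, ∀ x ∈ W i, s x ∈ W i)
  (hzero : ∀ i j, i ≠ j → ∀ f : Module.End K V, (∀ x ∈ W i, f x ∈ W j) →
    (∀ s ∈ S, ∀ x ∈ W i, f (s x) = s (f x)) → ∀ x ∈ W i, f x = 0)

include ind top hstab hzero in
/-- **Operators in the commutant preserve the constituents.**  If for `i ≠ j` every `K`-linear map carrying `W i`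
into `W j` and commuting with `S` on `W i` vanishes on `W i` (Schur's lemma for non-isomorphic simple constituents,
taken as the hypothesis `hzero`), then every operator `c` commuting with all of `S` maps each `W i` into itself: its
off-diagonal blocks `pr_j ∘ c|_{W i}` are such maps. [cite: BourbakiAlgebreVIII2012, §4 n°6 Prop. 4 b) and Prop. 5 b) (pp. VIII.61–62)] -/
theorem apply_mem_of_forall_commute {c : Module.End K V} (hc : ∀ s ∈ S, c * s = s * c) (i : ι) {x : V}
    (hx : x ∈ W i) : c x ∈ W i := by
  classical
  refine mem_of_forall_coord_eq_zero ind top fun j hj => ?_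
  -- the off-diagonal block `pr_j ∘ c` is an `S`-map `W i → W j`, hence zero on `W i`
  have hblock := hzero i j (Ne.symm hj)
    ((W j).subtype ∘ₗ DFinsupp.lapply j ∘ₗ (ind.linearEquiv top).symm.toLinearMap ∘ₗ c)
    (fun y _ => by
      simp only [LinearMap.coe_comp, Submodule.coe_subtype, Function.comp_apply]
      exact Subtype.mem _)
    (fun s hs y _ => by
      show (((ind.linearEquiv top).symm (c (s y)) j : W j) : V) = s ((ind.linearEquiv top).symm (c y) j : W j)
      rw [show c (s y) = s (c y) by rw [← Module.End.mul_apply, hc s hs, Module.End.mul_apply]]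
      exact coord_apply_eq_apply_coord ind top (fun k z hz => hstab k s hs z hz) j (c y))
  simpa only [LinearMap.coe_comp, Submodule.coe_subtype, Function.comp_apply, DFinsupp.lapply_apply,
    LinearEquiv.coe_coe] using hblock x hx

end Preserve

/-! ## §3 Over an algebraically closed field it acts on each constituent by a scalar -/

section Scalar

variable {S : Set (Module.End K V)}
  (hsimple : ∀ i, W i ≠ ⊥ ∧ ∀ U : Submodule K V, U ≤ W i → U ≠ ⊥ → (∀ s ∈ S, ∀ x ∈ U, s x ∈ U) → U = W i)

include hsimple in
/-- **Schur's lemma on one simple constituent.**  Over an algebraically closed field, an operator `c` commuting with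
`S` and preserving the finite-dimensional `S`-simple subspace `W i` acts on it by a scalar: an eigenvalue `μ` of
`c|_{W i}` exists, and `ker (c - μ) ∩ W i` is a non-zero `S`-stable subspace of `W i`, hence all of it.
[cite: BourbakiAlgebreVIII2012, §3 n°2 Prop. 2, Cor. and Th. 1 (p. VIII.43)] -/
theorem exists_apply_eq_smul_of_forall_commute_of_mapsTo [IsAlgClosed K] (hstab : ∀ i, ∀ s ∈ S, ∀ x ∈ W i, s x ∈ W i)
    {c : Module.End K V} (hc : ∀ s ∈ S, c * s = s * c) (i : ι) [FiniteDimensional K (W i)]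
    (hci : ∀ x ∈ W i, c x ∈ W i) : ∃ μ : K, ∀ x ∈ W i, c x = μ • x := by
  haveI : Nontrivial (W i) := Submodule.nontrivial_iff_ne_bot.2 (hsimple i).1
  obtain ⟨μ, hμ⟩ := Module.End.exists_eigenvalue (c.restrict hci)
  refine ⟨μ, ?_⟩
  -- the `μ`-eigenspace of `c` inside `W i`
  set U : Submodule K V := W i ⊓ LinearMap.ker (c - μ • LinearMap.id) with hU
  have hmem : ∀ {x : V}, x ∈ U ↔ x ∈ W i ∧ c x = μ • x := by
    intro x
    rw [hU, Submodule.mem_inf, LinearMap.mem_ker, LinearMap.sub_apply, LinearMap.smul_apply, LinearMap.id_apply,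
      sub_eq_zero]
  have hUle : U ≤ W i := fun x hx => (hmem.1 hx).1
  have hU0 : U ≠ ⊥ := by
    obtain ⟨v, hv⟩ := hμ.exists_hasEigenvector
    refine (Submodule.ne_bot_iff U).2 ⟨(v : V), hmem.2 ⟨v.2, ?_⟩, fun h => hv.2 (Subtype.ext h)⟩
    have := congrArg Subtype.val hv.apply_eq_smul
    simpa only [LinearMap.restrict_apply, Submodule.coe_smul] using this
  have hUstab : ∀ s ∈ S, ∀ x ∈ U, s x ∈ U := by
    intro s hs x hx
    obtain ⟨hxi, hcx⟩ := hmem.1 hx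
    refine hmem.2 ⟨hstab i s hs x hxi, ?_⟩
    rw [← Module.End.mul_apply, hc s hs, Module.End.mul_apply, hcx, map_smul]
  have hUeq := (hsimple i).2 U hUle hU0 hUstab
  intro x hx
  rw [← hUeq] at hx
  exact (hmem.1 hx).2

end Scalar

/-! ## §4 The commutant is commutative -/

section Commute

variable {S : Set (Module.End K V)} (ind : iSupIndep W) (top : ⨆ i, W i = ⊤)
  (hstab : ∀ i, ∀ s ∈ S, ∀ x ∈ W i, s x ∈ W i)
  (hzero : ∀ i j, i ≠ j → ∀ f : Module.End K V, (∀ x ∈ W i, f x ∈ W j) →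
    (∀ s ∈ S, ∀ x ∈ W i, f (s x) = s (f x)) → ∀ x ∈ W i, f x = 0)
  (hsimple : ∀ i, W i ≠ ⊥ ∧ ∀ U : Submodule K V, U ≤ W i → U ≠ ⊥ → (∀ s ∈ S, ∀ x ∈ U, s x ∈ U) → U = W i)

include ind top hstab hzero hsimple in
/-- **On each constituent an operator of the commutant is a scalar** (§2 + §3): for `K` algebraically closed, the `W i`
finite-dimensional, `S`-simple and pairwise `S`-non-isomorphic (hypotheses `hsimple`, `hzero`), every `c` with
`c s = s c` (`s ∈ S`) satisfies `c|_{W i} = μ_i · 1`. [cite: BourbakiAlgebreVIII2012, §4 n°6 Prop. 4 b) and Prop. 5 b) (pp. VIII.61–62); §3 n°2 Th. 1 (p. VIII.43)] -/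
theorem exists_apply_eq_smul_of_forall_commute [IsAlgClosed K] (hfin : ∀ i, FiniteDimensional K (W i))
    {c : Module.End K V} (hc : ∀ s ∈ S, c * s = s * c) (i : ι) : ∃ μ : K, ∀ x ∈ W i, c x = μ • x := by
  classical
  haveI := hfin i
  exact exists_apply_eq_smul_of_forall_commute_of_mapsTo hsimple hstab hc i
    (fun x hx => apply_mem_of_forall_commute ind top hstab hzero hc i hx)

include ind top hstab hzero hsimple in
/-- **The commutant of a multiplicity-free family is commutative.**  `K` algebraically closed, `V = ⊕ W i` an internal
direct sum of finite-dimensional `S`-stable, `S`-simple, pairwise `S`-non-isomorphic subspaces: any two operators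
commuting with `S` commute with each other — both are diagonal with scalar blocks (`exists_apply_eq_smul_of_forall_commute`)
and `V` is spanned by the `W i`.  The «multiplicity one ⇒ commutative commutant» sentence consumed by the tree's CM lever
`HodgeTheory.isOfCMType_of_centralizer_bettiCohomology_comm`. [cite: BourbakiAlgebreVIII2012, §4 n°6 Prop. 4 b) and Prop. 5 b) (pp. VIII.61–62); §3 n°2 Th. 1 (p. VIII.43)] -/
theorem commute_of_forall_commute [IsAlgClosed K] (hfin : ∀ i, FiniteDimensional K (W i))
    {c d : Module.End K V} (hc : ∀ s ∈ S, c * s = s * c) (hd : ∀ s ∈ S, d * s = s * d) : c * d = d * c := by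
  classical
  ext v
  have hv : v ∈ ⨆ i, W i := by rw [top]; exact Submodule.mem_top
  induction hv using Submodule.iSup_induction' with
  | mem i x hx =>
    obtain ⟨μ, hμ⟩ := exists_apply_eq_smul_of_forall_commute ind top hstab hzero hsimple hfin hc i
    obtain ⟨ν, hν⟩ := exists_apply_eq_smul_of_forall_commute ind top hstab hzero hsimple hfin hd i
    have hdx : d x ∈ W i := apply_mem_of_forall_commute ind top hstab hzero hd i hx
    have hcx : c x ∈ W i := apply_mem_of_forall_commute ind top hstab hzero hc i hx
    rw [Module.End.mul_apply, Module.End.mul_apply, hμ _ hdx, hν _ hx, hν _ hcx, hμ _ hx, smul_smul, smul_smul,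
      mul_comm]
  | zero => simp only [map_zero]
  | add x y _ _ hx hy => simp only [map_add, hx, hy]

include ind top hstab hzero hsimple in
/-- **The commutant `C_K(S) = Subalgebra.centralizer K S` of a multiplicity-free family is a commutative algebra**
(`commute_of_forall_commute` read on Mathlib's centraliser subalgebra). [cite: BourbakiAlgebreVIII2012, §4 n°6 Prop. 4 b) and Prop. 5 b) (pp. VIII.61–62)] -/
theorem centralizer_comm [IsAlgClosed K] (hfin : ∀ i, FiniteDimensional K (W i)) :
    ∀ c ∈ Subalgebra.centralizer K S, ∀ d ∈ Subalgebra.centralizer K S, c * d = d * c := fun _ hc _ hd =>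
  commute_of_forall_commute ind top hstab hzero hsimple hfin
    (fun s hs => ((Subalgebra.mem_centralizer_iff K).1 hc s hs).symm)
    (fun s hs => ((Subalgebra.mem_centralizer_iff K).1 hd s hs).symm)

end Commute

end Literature.RingTheory.SimpleModule.MultiplicityFree

end
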